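import Mathlib
import Literature.Analysis.FluidPDE.LocalBiotSavartCalculus
import Literature.Analysis.FluidPDE.VorticityEquation
import Literature.Analysis.FluidPDE.CurlFreeLiouville
import Literature.Analysis.FluidPDE.LerayProfileCalculus
import Literature.Analysis.FluidPDE.SelfSimilar
import Summits.NavierStokesRegularity.NavierStokesRegularity.Theorems.IsobarTomographyIsobaricLinesLiouvilleIsometryTools

/-!
# Screw leaf — crux stmt-NavierStokesRegularity-11741 (`IsobarTomography.IsobaricLinesLiouville`),
# line Ideator2Sketch (card flux-surface-persistence), stub `stub_screwLeaf` (hull (D))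

A bounded ancient mild solution `v` (`ν = 1`), classical on `(-∞,0) × ℝ³` with pressure `q` and
isobaric vortex lines `⟪ω, ∇q⟫ ≡ 0` (`ω = curl v`), whose vorticity is everywhere along the screw
Killing field `K(x) = a × (x − c) + b`, `⟪a, b⟫ ≠ 0`, and which has no screw swirl, `⟪v, K⟫ ≡ 0`,
is constant on every time slice.

Proof (pointwise, elementary). Fix `t < 0`, `x`, and dot the momentum equation
`∂ₜv + (v·∇)v = Δv − ∇q` (`IsClassicalNSSolutionOn.momentum`) with `K = K(x)`:
* `⟪∂ₜv, K⟫ = 0`, because `s ↦ ⟪v s x, K⟫ ≡ 0` on `(-∞,0)`;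
* `⟪(v·∇)v, K⟫ = ⟪Dv(x) v, K⟫ = −⟪v, a × v⟫ = 0`, differentiating `⟪v, K⟫ ≡ 0` along `v(x)`
  (`DK = a × ·`);
* `⟪Δv, K⟫ = −2⟪a, ω⟫`, from the Leibniz rule
  `Δ⟪v, K⟫ = ⟪Δv, K⟫ + ⟪v, ΔK⟫ + 2 Σᵢ ⟪∂ᵢv, ∂ᵢK⟫` (`laplacian_inner_eq`) with `Δ⟪v,K⟫ = 0`,
  `ΔK = 0` (affine) and the coordinate identity `Σᵢ ⟪∂ᵢv, a × eᵢ⟫ = ⟪a, curl v⟫.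
Hence the swirl-source law `⟪∇q, K⟫ = −2⟪a, ω⟫`. With `ω × K = 0` (Lagrange:
`‖K‖² ω = ⟪ω, K⟫ K`), `⟪ω, ∇q⟫ = 0` and `⟪a, K⟫ = ⟪a, b⟫ ≠ 0` this forces `ω = 0`. So every slice
is curl- and divergence-free and bounded, hence constant
(`eq_of_curl_eq_zero_of_isDivFree_of_bounded`, Liouville for harmonic functions).
-/

noncomputable section

open scoped InnerProductSpace RealInnerProductSpace ContDiff Laplacian
open Literature.Analysis.FluidPDE Set Function WithLp

-- the problem directory repeats the summit name (`NavierStokesRegularity/NavierStokesRegularity`,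
-- D-0017), which core's `dupNamespace` linter reports on every declaration of this namespace
set_option linter.dupNamespace false

namespace Summit.NavierStokesRegularity.NavierStokesRegularity.Theorems.IsobaricLinesLiouville.FluxSurfacePersistence

/-! ### Pointwise linear algebra of the cross product -/

/-- `⟪a, a × w⟫ = 0` (Mathlib `dot_self_cross`, transported to `EuclideanSpace ℝ (Fin 3)`). -/
theorem screwLeaf_inner_self_cross (a w : EuclideanSpace ℝ (Fin 3)) : ⟪a, cross a w⟫_ℝ = 0 := by
  rw [← dotProduct_ofLp]
  exact dot_self_cross (ofLp a) (ofLp w)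

/-- `⟪w, a × w⟫ = 0` (Mathlib `dot_cross_self`, transported to `EuclideanSpace ℝ (Fin 3)`). -/
theorem screwLeaf_inner_cross_self (a w : EuclideanSpace ℝ (Fin 3)) : ⟪w, cross a w⟫_ℝ = 0 := by
  rw [← dotProduct_ofLp]
  exact dot_cross_self (ofLp a) (ofLp w)

/-- The screw Killing field is never orthogonal to its axis: `⟪a, a × w + b⟫ = ⟪a, b⟫`. -/
theorem screwLeaf_inner_killing (a b w : EuclideanSpace ℝ (Fin 3)) :
    ⟪a, cross a w + b⟫_ℝ = ⟪a, b⟫_ℝ := by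
  rw [inner_add_right, screwLeaf_inner_self_cross, zero_add]

/-- **Lagrange's formula for parallel vectors**: `ω × K = 0` implies `‖K‖² ω = ⟪ω, K⟫ K`
(the expansion `K × (ω × K) = ⟪K,K⟫ ω − ⟪K,ω⟫ K`, checked in coordinates). -/
theorem screwLeaf_lagrange (w K : EuclideanSpace ℝ (Fin 3)) (h : cross w K = 0) :
    ⟪K, K⟫_ℝ • w = ⟪w, K⟫_ℝ • K := by
  have h0 : ∀ i, (cross w K) i = 0 := fun i => by rw [h]; rfl
  have e0 := h0 0
  have e1 := h0 1
  have e2 := h0 2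
  simp only [cross, PiLp.toLp_apply, cross_apply, Matrix.cons_val_zero, Matrix.cons_val_one,
    Matrix.cons_val_two, Matrix.head_cons, Matrix.tail_cons] at e0 e1 e2
  have hKK : ⟪K, K⟫_ℝ = K 0 * K 0 + K 1 * K 1 + K 2 * K 2 := by
    simp only [PiLp.inner_apply, RCLike.inner_apply, conj_trivial, Fin.sum_univ_three]
  have hwK : ⟪w, K⟫_ℝ = w 0 * K 0 + w 1 * K 1 + w 2 * K 2 := by
    simp only [PiLp.inner_apply, RCLike.inner_apply, conj_trivial, Fin.sum_univ_three]
    ring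
  rw [hKK, hwK]
  ext i
  fin_cases i
  · simp only [PiLp.smul_apply, smul_eq_mul, Fin.zero_eta, Fin.isValue]
    linear_combination (K 1) * e2 - (K 2) * e1
  · simp only [PiLp.smul_apply, smul_eq_mul, Fin.mk_one, Fin.isValue]
    linear_combination (K 2) * e0 - (K 0) * e2
  · simp only [PiLp.smul_apply, smul_eq_mul, Fin.reduceFinMk, Fin.isValue]
    linear_combination (K 0) * e1 - (K 1) * e0

/-- **The pointwise contradiction of the screw leaf.** If `⟪a, K⟫ ≠ 0`, `ω × K = 0`,
`⟪ω, g⟫ = 0` and `⟪g, K⟫ = −2⟪a, ω⟫`, then `ω = 0`: writing `‖K‖² ω = s K` with `s = ⟪ω, K⟫`,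
`s ⟪K, g⟫ = 0` and `‖K‖² ⟪a, ω⟫ = s ⟪a, K⟫`, so `s ≠ 0` would give `⟪a, ω⟫ = 0` and then
`s ⟪a, K⟫ = 0`; hence `s = 0` and `‖K‖² ω = 0` with `K ≠ 0`. -/
theorem screwLeaf_pointwise (w K a g : EuclideanSpace ℝ (Fin 3)) (haK : ⟪a, K⟫_ℝ ≠ 0)
    (hcross : cross w K = 0) (hiso : ⟪w, g⟫_ℝ = 0) (hsrc : ⟪g, K⟫_ℝ = -2 * ⟪a, w⟫_ℝ) :
    w = 0 := by
  have hL := screwLeaf_lagrange w K hcross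
  have hK : ⟪K, K⟫_ℝ ≠ 0 := by
    intro h0
    apply haK
    rw [inner_self_eq_zero.1 h0, inner_zero_right]
  have h1 : ⟪w, K⟫_ℝ * ⟪K, g⟫_ℝ = 0 := by
    have := congrArg (fun z => ⟪z, g⟫_ℝ) hL
    simp only [real_inner_smul_left, hiso, mul_zero] at this
    exact this.symm
  have h2 : ⟪K, K⟫_ℝ * ⟪a, w⟫_ℝ = ⟪w, K⟫_ℝ * ⟪a, K⟫_ℝ := by
    have := congrArg (fun z => ⟪a, z⟫_ℝ) hL
    simp only [real_inner_smul_right] at this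
    exact this
  have h3 : ⟪w, K⟫_ℝ * ⟪a, w⟫_ℝ = 0 := by
    rw [real_inner_comm g K, hsrc] at h1
    linear_combination (-1 / 2 : ℝ) * h1
  have hs : ⟪w, K⟫_ℝ = 0 := by
    by_contra hs
    have haw : ⟪a, w⟫_ℝ = 0 := (mul_eq_zero.1 h3).resolve_left hs
    rw [haw, mul_zero] at h2
    exact hs ((mul_eq_zero.1 h2.symm).resolve_right haK)
  rw [hs, zero_smul] at hL
  exact (smul_eq_zero.1 hL).resolve_left hK

/-- The coordinate identity behind `⟪Δv, K⟫ = −2⟪a, ω⟫`: for a linear `D` (the Jacobian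
`Dv(x)`) and the derivative `h ↦ a × h` of the screw field,
`Σᵢ ⟪D eᵢ, a × eᵢ⟫ = ⟪a, curl D⟫` with `curl D = curlCLM D`. -/
theorem screwLeaf_sum_inner_apply_cross (D : EuclideanSpace ℝ (Fin 3) →L[ℝ] EuclideanSpace ℝ (Fin 3))
    (a : EuclideanSpace ℝ (Fin 3)) :
    ∑ i, ⟪D (EuclideanSpace.basisFun (Fin 3) ℝ i), cross a (EuclideanSpace.basisFun (Fin 3) ℝ i)⟫_ℝ =
      ⟪a, curlCLM D⟫_ℝ := by
  simp only [EuclideanSpace.basisFun_apply, Fin.sum_univ_three, PiLp.inner_apply,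
    RCLike.inner_apply, conj_trivial, curlCLM_apply, cross, cross_apply, PiLp.single_apply,
    Matrix.cons_val_zero, Matrix.cons_val_one, Matrix.cons_val_two, Matrix.head_cons,
    Matrix.tail_cons]
  simp [show (0 : Fin 3) ≠ 1 by decide, show (0 : Fin 3) ≠ 2 by decide,
    show (1 : Fin 3) ≠ 0 by decide, show (1 : Fin 3) ≠ 2 by decide,
    show (2 : Fin 3) ≠ 0 by decide, show (2 : Fin 3) ≠ 1 by decide]
  ring

/-! ### The swirl-source law -/

/-- **Swirl-source law for the screw Killing field.** For a classical Navier–Stokes solution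
(`ν = 1`, `f = 0`) on `(-∞,0) × ℝ³` without screw swirl, `⟪v, K⟫ ≡ 0` for
`K(y) = a × (y − c) + b`, the momentum equation dotted with `K` reads `⟪∇q, K⟫ = −2⟪a, curl v⟫`
pointwise: the time-derivative and convective terms vanish (`∂ₜ⟪v,K⟫ = 0`,
`⟪Dv v, K⟫ = −⟪v, a × v⟫ = 0`) and `⟪Δv, K⟫ = Δ⟪v,K⟫ − 2Σᵢ⟪∂ᵢv, a × eᵢ⟫ = −2⟪a, curl v⟫`. -/
theorem screwLeaf_inner_gradient_killing
    (v : ℝ → EuclideanSpace ℝ (Fin 3) → EuclideanSpace ℝ (Fin 3)) (q : ℝ → EuclideanSpace ℝ (Fin 3) → ℝ)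
    (hcl : IsClassicalNSSolutionOn (Set.Iio 0) 1 0 v q) (a b c : EuclideanSpace ℝ (Fin 3))
    (hsw : ∀ s < 0, ∀ y : EuclideanSpace ℝ (Fin 3), ⟪v s y, cross a (y - c) + b⟫_ℝ = 0)
    {t : ℝ} (ht : t < 0) (x : EuclideanSpace ℝ (Fin 3)) :
    ⟪gradient (q t) x, cross a (x - c) + b⟫_ℝ = -2 * ⟪a, curl (v t) x⟫_ℝ := by
  have ht' : t ∈ Set.Iio (0 : ℝ) := ht
  have hS : UniqueDiffOn ℝ (Set.Iio (0 : ℝ)) := isOpen_Iio.uniqueDiffOn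
  have hv2 : ContDiff ℝ 2 (v t) := (hcl.contDiff_velocity ht').of_le (by norm_cast)
  have hvx : DifferentiableAt ℝ (v t) x := (hv2.differentiable (by norm_num)) x
  -- the screw Killing field is affine with derivative `h ↦ a × h`
  have hKfun : (fun y : EuclideanSpace ℝ (Fin 3) => cross a (y - c) + b) =
      fun y => crossCLM a y + (b - crossCLM a c) := by
    funext y
    rw [← crossCLM_apply, map_sub]
    abel
  have hKd : ∀ y : EuclideanSpace ℝ (Fin 3),
      HasFDerivAt (fun y : EuclideanSpace ℝ (Fin 3) => cross a (y - c) + b) (crossCLM a) y := by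
    intro y
    rw [hKfun]
    exact (crossCLM a).hasFDerivAt.add_const _
  have hKf : ∀ y : EuclideanSpace ℝ (Fin 3),
      fderiv ℝ (fun y : EuclideanSpace ℝ (Fin 3) => cross a (y - c) + b) y = crossCLM a :=
    fun y => (hKd y).fderiv
  have hK2 : ContDiff ℝ 2 (fun y : EuclideanSpace ℝ (Fin 3) => cross a (y - c) + b) := by
    rw [hKfun]
    exact (crossCLM a).contDiff.add contDiff_const
  -- the swirl vanishes identically on the slice
  have hg0 : (fun y => ⟪v t y, cross a (y - c) + b⟫_ℝ) = fun _ => (0 : ℝ) := funext (hsw t ht)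
  -- (1) the time derivative pairs to zero
  have hT : ⟪timeDerivWithin (Set.Iio 0) v t x, cross a (x - c) + b⟫_ℝ = 0 := by
    have hd := hcl.smooth_velocity.hasDerivWithinAt_timeDerivWithin hS ht' x
    have h1 := (hd.inner ℝ (hasDerivWithinAt_const t (Set.Iio (0 : ℝ))
      (cross a (x - c) + b))).derivWithin (hS t ht')
    have hEq : Set.EqOn (fun s => ⟪v s x, cross a (x - c) + b⟫_ℝ) (fun _ => (0 : ℝ))
        (Set.Iio 0) := fun s hs => hsw s hs x
    have h2 : derivWithin (fun s => ⟪v s x, cross a (x - c) + b⟫_ℝ) (Set.Iio 0) t = 0 := by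
      rw [derivWithin_congr hEq (hsw t ht x)]
      simp
    rw [h2, inner_zero_right, zero_add] at h1
    exact h1.symm
  -- (2) the convective term pairs to zero
  have hC : ⟪convect (v t) (v t) x, cross a (x - c) + b⟫_ℝ = 0 := by
    have h1 : fderiv ℝ (fun y => ⟪v t y, cross a (y - c) + b⟫_ℝ) x (v t x) =
        ⟪v t x, fderiv ℝ (fun y : EuclideanSpace ℝ (Fin 3) => cross a (y - c) + b) x (v t x)⟫_ℝ +
          ⟪fderiv ℝ (v t) x (v t x), cross a (x - c) + b⟫_ℝ :=
      fderiv_inner_apply ℝ hvx (hKd x).differentiableAt (v t x)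
    rw [hg0, hKf x, crossCLM_apply, screwLeaf_inner_cross_self, zero_add,
      fderiv_const_apply, zero_apply] at h1
    rw [convect_apply]
    exact h1.symm
  -- (3) the viscous term: `⟪Δv, K⟫ = -2⟪a, ω⟫`
  have hV : ⟪(Δ (v t)) x, cross a (x - c) + b⟫_ℝ = -2 * ⟪a, curl (v t) x⟫_ℝ := by
    have h1 := laplacian_inner_eq (EuclideanSpace.basisFun (Fin 3) ℝ) hv2 hK2 x
    have hΔK : (Δ (fun y : EuclideanSpace ℝ (Fin 3) => cross a (y - c) + b)) x = 0 := by
      rw [laplacian_eq_sum_fderiv_fderiv (EuclideanSpace.basisFun (Fin 3) ℝ) hK2 x]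
      simp [hKf]
    have hsum : ∑ i, ⟪fderiv ℝ (v t) x (EuclideanSpace.basisFun (Fin 3) ℝ i),
        fderiv ℝ (fun y : EuclideanSpace ℝ (Fin 3) => cross a (y - c) + b) x
          (EuclideanSpace.basisFun (Fin 3) ℝ i)⟫_ℝ = ⟪a, curl (v t) x⟫_ℝ := by
      simp_rw [hKf x, crossCLM_apply]
      rw [screwLeaf_sum_inner_apply_cross, curl_eq_curlCLM]
    rw [hg0, hΔK, hsum, inner_zero_right, add_zero, laplacian_const_eq_zero] at h1
    beta_reduce at h1
    linarith
  -- (4) the momentum equation dotted with `K`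
  have hm := hcl.momentum t ht' x
  rw [one_smul, Pi.zero_apply, Pi.zero_apply, add_zero] at hm
  have key := congrArg (fun w => ⟪w, cross a (x - c) + b⟫_ℝ) hm
  simp only [inner_add_left, inner_sub_left, hT, hC, hV] at key
  linarith

/-! ### The leaf -/

/-- **Screw leaf** (hull (D)): an isobaric bounded ancient mild solution (classical on `(-∞,0)`)
whose vorticity is everywhere along the screw Killing field `K(x) = a × (x − c) + b`, `⟪a,b⟫ ≠ 0`,
and which has no screw swirl, `⟪v, K⟫ = 0`, at all `t < 0`, is constant on every slice.
Route: the swirl-source law `⟪∇q, K⟫ = −2⟪a, ω⟫` (`screwLeaf_inner_gradient_killing`); where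
`ω ≠ 0`, `ω = λK` and `ω·∇q = 0` give `⟪K,∇q⟫ = 0`, hence `λ⟪a,K⟫ = λ⟪a,b⟫ = 0`, contradiction
(`screwLeaf_pointwise`); so `ω ≡ 0` and `eq_of_curl_eq_zero_of_isDivFree_of_bounded` concludes. -/
theorem stub_screwLeaf :
    ∀ (v : ℝ → (EuclideanSpace ℝ (Fin 3)) → (EuclideanSpace ℝ (Fin 3)))
      (q : ℝ → (EuclideanSpace ℝ (Fin 3)) → ℝ),
      IsBoundedAncientMildSolution 1 v → IsClassicalNSSolutionOn (Set.Iio 0) 1 0 v q →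
      (∀ t < 0, ∀ x : EuclideanSpace ℝ (Fin 3), ⟪curl (v t) x, gradient (q t) x⟫_ℝ = 0) →
      ∀ (a b c : EuclideanSpace ℝ (Fin 3)), ⟪a, b⟫_ℝ ≠ 0 →
      (∀ t < 0, ∀ x : EuclideanSpace ℝ (Fin 3),
          cross (curl (v t) x) (cross a (x - c) + b) = 0 ∧ ⟪v t x, cross a (x - c) + b⟫_ℝ = 0) →
      ∀ t < 0, ∃ b₀ : EuclideanSpace ℝ (Fin 3), v t = fun _ => b₀ := by
  intro v q hanc hcl hiso a b c hab h t ht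
  -- the vorticity vanishes identically on the slice
  have hcurl : ∀ x, curl (v t) x = 0 := fun x =>
    screwLeaf_pointwise (curl (v t) x) (cross a (x - c) + b) a (gradient (q t) x)
      (by rwa [screwLeaf_inner_killing]) (h t ht x).1 (hiso t ht x)
      (screwLeaf_inner_gradient_killing v q hcl a b c (fun s hs y => (h s hs y).2) ht x)
  -- bounded, curl-free and divergence-free slices are constant
  have hv2 : ContDiff ℝ 2 (v t) := (hcl.contDiff_velocity ht).of_le (by norm_cast)
  obtain ⟨M, hM⟩ := hanc.2
  exact ⟨v t 0, funext fun x =>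
    eq_of_curl_eq_zero_of_isDivFree_of_bounded hv2 hcurl (hcl.divFree t ht) (hM t ht) x 0⟩

end Summit.NavierStokesRegularity.NavierStokesRegularity.Theorems.IsobaricLinesLiouville.FluxSurfacePersistence

end
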